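import Summits.SmoothPoincare4.SmoothPoincare4.Theorems.EntropyRungSubcylindricalExistenceConformalRealisation
import Literature.Geometry.Riemannian.RoundCylinderFour
import Literature.Geometry.Riemannian.HuiskenMonotonicity
import HarnessLib

/-!
# A radial conformally flat metric `e^{2θ(‖x‖²)} δ` on `ℝ⁴` with `Ric ≥ 0`
(aux file 1 of stub `helper_smoothedConeModel`, line `fat-conical-core-avr-logsobolev`, crux
`EntropyRung.SubcylindricalExistence`, item stmt-SmoothPoincare4-10871)

For a smooth profile `θ : ℝ → ℝ` put `W(x) = θ(‖x‖²)` on `ℝ⁴ = EuclideanSpace ℝ (Fin 4)` and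
`g_c = e^{2W} δ`. With `a = θ'(s)`, `b = θ''(s)`, `s = ‖x‖²`, Besse's law for the Ricci tensor of
a conformal metric in dimension four (`PseudoRiemannianMetric.ricci_conformal_exp_four`,
`Ric' = −2(Hess W − dW ⊗ dW) − (ΔW + 2|dW|²) δ` on the flat base) gives
`Ric(g_c)_x(Y, Y) = 8 (a² − b) ⟪x, Y⟫² − (12 a + 4 b s + 8 a² s) ‖Y‖²`
(`ricci_radial_self`), whose radial and tangential eigenvalues are `−12(a + b s)` and
`−(12a + 4bs + 8a²s)`. Hence (`helper_smoothedConeModel_metric`): if `a + b s ≤ 0` and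
`12 a + 4 b s + 8 a² s ≤ 0` for `s ≥ 0`, the metric `g_c` — realised as a smooth Riemannian
`PseudoRiemannianMetric` on `ℝ⁴` with its Levi-Civita connection
(`ConformalRealisation.exists_isRiemannian_conformal_sq` applied to the Euclidean metric) — has
`Ric ≥ 0`. The flat base is read through `ricci_euclideanMetric`,
`hessian_euclideanMetric_eq_fderiv_fderiv`, and `dalembertian_of_flatOn` / `innerDual_of_flatOn` in
the identity chart. Everything is proved; no definition, no named fact.

References: A. L. Besse, *Einstein Manifolds* (1987), Thm. 1.159 (d) [Besse1987]; P. Petersen,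
*Riemannian Geometry*, 3rd ed. (2016), §4.2.3 (rotationally symmetric / conformally flat metrics)
[Petersen2016].
-/

noncomputable section

-- the registered namespace `Summit.SmoothPoincare4.SmoothPoincare4.Theorems` repeats a component
set_option linter.dupNamespace false

open scoped Manifold ContDiff Topology RealInnerProductSpace
open Set Filter Function
open Literature.Geometry.Lorentzian Literature.Geometry.Riemannian

namespace Summit.SmoothPoincare4.SmoothPoincare4.Theorems

namespace SmoothedConeModelMetric

/-! ## Calculus of the radial exponent `W(x) = θ(‖x‖²)` -/

/-- `dW_x = 2 θ'(‖x‖²) ⟪x, ·⟫` for `W = θ(‖·‖²)`. [folklore] -/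
theorem hasFDerivAt_radial {θ : ℝ → ℝ} (hθ : ContDiff ℝ ∞ θ) (x : EuclideanFour) :
    HasFDerivAt (fun y : EuclideanFour ↦ θ (‖y‖ ^ 2))
      ((2 * deriv θ (‖x‖ ^ 2)) • innerSL ℝ x) x := by
  have h1 : HasFDerivAt (fun y : EuclideanFour ↦ ‖y‖ ^ 2) (2 • innerSL ℝ x) x :=
    (hasStrictFDerivAt_norm_sq x).hasFDerivAt
  have h2 : HasDerivAt θ (deriv θ (‖x‖ ^ 2)) (‖x‖ ^ 2) :=
    ((hθ.differentiable (by simp)).differentiableAt).hasDerivAt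
  have h := h2.comp_hasFDerivAt x h1
  refine h.congr_fderiv ?_
  ext v
  simp only [smul_apply, innerSL_apply_apply, smul_eq_mul, nsmul_eq_mul, Nat.cast_ofNat]
  ring

/-- The first derivative of `W = θ(‖·‖²)` as a function. [folklore] -/
theorem fderiv_radial_eq {θ : ℝ → ℝ} (hθ : ContDiff ℝ ∞ θ) :
    fderiv ℝ (fun y : EuclideanFour ↦ θ (‖y‖ ^ 2)) =
      fun x ↦ (2 * deriv θ (‖x‖ ^ 2)) • innerSL ℝ x :=
  funext fun x ↦ (hasFDerivAt_radial hθ x).fderiv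

/-- `dW_x(v) = 2 θ'(‖x‖²) ⟪x, v⟫`. [folklore] -/
theorem fderiv_radial_apply {θ : ℝ → ℝ} (hθ : ContDiff ℝ ∞ θ) (x v : EuclideanFour) :
    fderiv ℝ (fun y : EuclideanFour ↦ θ (‖y‖ ^ 2)) x v = 2 * deriv θ (‖x‖ ^ 2) * ⟪x, v⟫ := by
  rw [(hasFDerivAt_radial hθ x).fderiv, smul_apply, innerSL_apply_apply, smul_eq_mul]

/-- The derivative of `θ` is smooth. [folklore] -/
theorem contDiff_deriv {θ : ℝ → ℝ} (hθ : ContDiff ℝ ∞ θ) : ContDiff ℝ ∞ (deriv θ) :=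
  (contDiff_infty_iff_deriv.mp hθ).2

/-- `D²W_x(Y)(Z) = 2 θ'(s) ⟪Y, Z⟫ + 4 θ''(s) ⟪x, Y⟫ ⟪x, Z⟫`, `s = ‖x‖²`. [folklore] -/
theorem fderiv_fderiv_radial_apply {θ : ℝ → ℝ} (hθ : ContDiff ℝ ∞ θ) (x Y Z : EuclideanFour) :
    fderiv ℝ (fderiv ℝ (fun y : EuclideanFour ↦ θ (‖y‖ ^ 2))) x Y Z =
      2 * deriv θ (‖x‖ ^ 2) * ⟪Y, Z⟫ +
        4 * deriv (deriv θ) (‖x‖ ^ 2) * ⟪x, Y⟫ * ⟪x, Z⟫ := by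
  rw [fderiv_radial_eq hθ]
  -- derivative of `y ↦ c(y) • innerSL y`, `c(y) = 2 θ'(‖y‖²)`
  have hc : HasFDerivAt (fun y : EuclideanFour ↦ 2 * deriv θ (‖y‖ ^ 2))
      ((2 : ℝ) • ((2 * deriv (deriv θ) (‖x‖ ^ 2)) • innerSL ℝ x)) x :=
    (hasFDerivAt_radial (contDiff_deriv hθ) x).const_mul 2
  have hL : HasFDerivAt (fun y : EuclideanFour ↦ (innerSL ℝ y : EuclideanFour →L[ℝ] ℝ))
      (innerSL ℝ : EuclideanFour →L[ℝ] EuclideanFour →L[ℝ] ℝ) x :=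
    (innerSL ℝ : EuclideanFour →L[ℝ] EuclideanFour →L[ℝ] ℝ).hasFDerivAt
  have hprod : HasFDerivAt (fun y : EuclideanFour ↦ (2 * deriv θ (‖y‖ ^ 2)) • innerSL ℝ y)
      ((2 * deriv θ (‖x‖ ^ 2)) • (innerSL ℝ : EuclideanFour →L[ℝ] EuclideanFour →L[ℝ] ℝ) +
        ((2 : ℝ) • ((2 * deriv (deriv θ) (‖x‖ ^ 2)) • innerSL ℝ x)).smulRight (innerSL ℝ x)) x :=
    hc.smul hL
  rw [hprod.fderiv]
  simp only [add_apply, smul_apply, innerSL_apply_apply, smul_eq_mul,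
    ContinuousLinearMap.smulRight_apply]
  have e : (innerSL ℝ : EuclideanFour →L[ℝ] EuclideanFour →L[ℝ] ℝ) Y Z = ⟪Y, Z⟫ := rfl
  rw [e]
  ring

/-! ## Sums over the standard basis of `ℝ⁴` -/

/-- `Σᵢ ⟪x, eᵢ⟫² = ‖x‖²` for the standard basis `eᵢ = EuclideanSpace.single i 1`. [folklore] -/
theorem sum_inner_single_sq (x : EuclideanFour) :
    ∑ i, ⟪x, (EuclideanSpace.single i (1 : ℝ) : EuclideanFour)⟫ ^ 2 = ‖x‖ ^ 2 := by
  have h := RoundCylinderFour.sum_inner_e4_sq x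
  simp only [RoundCylinderFour.e4_apply] at h
  exact h

/-- `Σᵢ ⟪eᵢ, eᵢ⟫ = 4`. [folklore] -/
theorem sum_inner_single_single :
    ∑ i : Fin 4, ⟪(EuclideanSpace.single i (1 : ℝ) : EuclideanFour), EuclideanSpace.single i 1⟫ = 4 := by
  have h := RoundCylinderFour.sum_inner_e4_e4
  simp only [RoundCylinderFour.e4_apply] at h
  exact h

/-! ## The flat base in the identity chart -/

/-- The identity chart of `ℝ⁴` is flat for the Euclidean metric (the hypothesis of the
`…_of_flatOn` lemmas of `FlatChartComputations.lean`). [folklore] -/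
theorem flatOn_refl : ∀ z ∈ (univ : Set EuclideanFour), ∀ v w,
    (euclideanMetric EuclideanFour).val ((OpenPartialHomeomorph.refl EuclideanFour).symm z) v w =
      (euclideanMetric EuclideanFour).val z
        (mfderiv 𝓘(ℝ, EuclideanFour) 𝓘(ℝ, EuclideanFour) (OpenPartialHomeomorph.refl EuclideanFour)
          ((OpenPartialHomeomorph.refl EuclideanFour).symm z) v)
        (mfderiv 𝓘(ℝ, EuclideanFour) 𝓘(ℝ, EuclideanFour) (OpenPartialHomeomorph.refl EuclideanFour)
          ((OpenPartialHomeomorph.refl EuclideanFour).symm z) w) := by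
  intro z _ v w
  simp only [OpenPartialHomeomorph.refl_symm]
  rw [show ((OpenPartialHomeomorph.refl EuclideanFour : EuclideanFour → EuclideanFour)) = id from rfl,
    mfderiv_id]
  rfl

/-- **The Laplacian of the Euclidean metric of `ℝ⁴` is `Σᵢ ∂ᵢ∂ᵢ`** (O'Neill 1983, Ch. 3,
Prop. 3.13 and Def. 3.50, through `dalembertian_of_flatOn` in the identity chart). [folklore] -/
theorem dalembertian_euclidean {F : EuclideanFour → ℝ} (hF : ContDiff ℝ ∞ F) (z : EuclideanFour) :
    (euclideanMetric EuclideanFour).dalembertian F z =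
      ∑ i, fderiv ℝ (fderiv ℝ F) z (EuclideanSpace.single i 1) (EuclideanSpace.single i 1) := by
  have he : OpenPartialHomeomorph.refl EuclideanFour ∈
      IsManifold.maximalAtlas 𝓘(ℝ, EuclideanFour) ∞ EuclideanFour :=
    StructureGroupoid.id_mem_maximalAtlas _
  have h := dalembertian_of_flatOn (euclideanMetric EuclideanFour) he isOpen_univ (subset_univ _)
    flatOn_refl (mem_univ z) (F := F) (hF.contMDiff.contMDiffAt.of_le (by norm_cast))
  simpa using h

/-- **The inverse Euclidean metric on a differential is `Σᵢ (∂ᵢF)²`** (O'Neill 1983, Ch. 3,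
p. 60, through `innerDual_of_flatOn` in the identity chart). [folklore] -/
theorem innerDual_euclidean {F : EuclideanFour → ℝ} (hF : ContDiff ℝ ∞ F) (z : EuclideanFour) :
    (euclideanMetric EuclideanFour).innerDual z (mvfderiv 𝓘(ℝ, EuclideanFour) F z).toLinearMap
        (mvfderiv 𝓘(ℝ, EuclideanFour) F z).toLinearMap =
      ∑ i, fderiv ℝ F z (EuclideanSpace.single i 1) * fderiv ℝ F z (EuclideanSpace.single i 1) := by
  have he : OpenPartialHomeomorph.refl EuclideanFour ∈
      IsManifold.maximalAtlas 𝓘(ℝ, EuclideanFour) ∞ EuclideanFour :=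
    StructureGroupoid.id_mem_maximalAtlas _
  have hd : MDifferentiableAt 𝓘(ℝ, EuclideanFour) 𝓘(ℝ, ℝ) F z :=
    hF.contMDiff.mdifferentiableAt (by simp)
  exact innerDual_of_flatOn (euclideanMetric EuclideanFour) he isOpen_univ (subset_univ _)
    flatOn_refl (mem_univ z) hd hd

/-- `mvfderiv` on the vector space `ℝ⁴` is `fderiv`. [folklore] -/
theorem mvfderiv_euclidean_apply (F : EuclideanFour → ℝ) (x v : EuclideanFour) :
    mvfderiv 𝓘(ℝ, EuclideanFour) F x v = fderiv ℝ F x v := by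
  simp only [mvfderiv, mfderiv_eq_fderiv]
  rfl

/-! ## The Ricci tensor of `e^{2θ(‖x‖²)} δ` -/

/-- **The Ricci tensor of the radial conformally flat metric** `g_c = e^{2θ(‖x‖²)} δ` on `ℝ⁴`:
`Ric(g_c)_x(Y,Y) = 8(a² − b)⟪x,Y⟫² − (12a + 4bs + 8a²s)‖Y‖²` with `a = θ'(s)`, `b = θ''(s)`,
`s = ‖x‖²` (Besse 1987, Thm. 1.159 (d) at `n = 4` on the flat base). [cite: Besse1987, Thm. 1.159 (d)] -/
theorem ricci_radial_self {θ : ℝ → ℝ} (hθ : ContDiff ℝ ∞ θ)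
    (gc : PseudoRiemannianMetric 𝓘(ℝ, EuclideanFour) ∞ EuclideanFour
      (TangentSpace 𝓘(ℝ, EuclideanFour) : EuclideanFour → Type _)) [gc.HasLeviCivita]
    (hval : ∀ (x : EuclideanFour) (v w : EuclideanFour),
      gc.val x v w = Real.exp (2 * θ (‖x‖ ^ 2)) * ⟪v, w⟫)
    (x Y : EuclideanFour) :
    gc.ricci x Y Y =
      8 * (deriv θ (‖x‖ ^ 2) ^ 2 - deriv (deriv θ) (‖x‖ ^ 2)) * ⟪x, Y⟫ ^ 2
        - (12 * deriv θ (‖x‖ ^ 2) + 4 * deriv (deriv θ) (‖x‖ ^ 2) * ‖x‖ ^ 2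
            + 8 * deriv θ (‖x‖ ^ 2) ^ 2 * ‖x‖ ^ 2) * ‖Y‖ ^ 2 := by
  have hWs : ContDiff ℝ ∞ (fun y : EuclideanFour ↦ θ (‖y‖ ^ 2)) := hθ.comp (contDiff_norm_sq ℝ)
  have hWm : ContMDiff 𝓘(ℝ, EuclideanFour) 𝓘(ℝ) ∞ (fun y : EuclideanFour ↦ θ (‖y‖ ^ 2)) :=
    hWs.contMDiff
  have h4 : Module.finrank ℝ EuclideanFour = 4 := finrank_euclideanSpace_fin
  have hgg' : ∀ (y : EuclideanFour) (v v' : TangentSpace 𝓘(ℝ, EuclideanFour) y),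
      gc.val y v v' = Real.exp (2 * (fun y : EuclideanFour ↦ θ (‖y‖ ^ 2)) y) *
        (euclideanMetric EuclideanFour).val y v v' := by
    intro y v v'
    rw [hval, euclideanMetric_apply]
    rfl
  have h := (euclideanMetric EuclideanFour).ricci_conformal_exp_four gc h4 hWm hgg' x Y Y
  have hric : (euclideanMetric EuclideanFour).ricci x Y Y = 0 := by
    rw [ricci_euclideanMetric]; rfl
  have hYY : ⟪Y, Y⟫ = ‖Y‖ ^ 2 := real_inner_self_eq_norm_sq Y
  have hhess : (euclideanMetric EuclideanFour).hessian (fun y : EuclideanFour ↦ θ (‖y‖ ^ 2)) x Y Y =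
      2 * deriv θ (‖x‖ ^ 2) * ‖Y‖ ^ 2 + 4 * deriv (deriv θ) (‖x‖ ^ 2) * ⟪x, Y⟫ * ⟪x, Y⟫ := by
    rw [hessian_euclideanMetric_eq_fderiv_fderiv (hWs.contDiffAt.of_le (by norm_cast)),
      fderiv_fderiv_radial_apply hθ, hYY]
  have hd : mvfderiv 𝓘(ℝ, EuclideanFour) (fun y : EuclideanFour ↦ θ (‖y‖ ^ 2)) x Y =
      2 * deriv θ (‖x‖ ^ 2) * ⟪x, Y⟫ := by
    rw [mvfderiv_euclidean_apply, fderiv_radial_apply hθ]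
  have hlap : (euclideanMetric EuclideanFour).dalembertian (fun y : EuclideanFour ↦ θ (‖y‖ ^ 2)) x =
      8 * deriv θ (‖x‖ ^ 2) + 4 * deriv (deriv θ) (‖x‖ ^ 2) * ‖x‖ ^ 2 := by
    rw [dalembertian_euclidean hWs]
    have hterm : ∀ i : Fin 4, fderiv ℝ (fderiv ℝ (fun y : EuclideanFour ↦ θ (‖y‖ ^ 2))) x
        (EuclideanSpace.single i 1) (EuclideanSpace.single i 1) =
        2 * deriv θ (‖x‖ ^ 2) * ⟪(EuclideanSpace.single i (1 : ℝ) : EuclideanFour),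
          EuclideanSpace.single i 1⟫ +
        4 * deriv (deriv θ) (‖x‖ ^ 2) * ⟪x, (EuclideanSpace.single i (1 : ℝ) : EuclideanFour)⟫ ^ 2 := by
      intro i
      rw [fderiv_fderiv_radial_apply hθ]
      ring
    simp_rw [hterm, Finset.sum_add_distrib, ← Finset.mul_sum, sum_inner_single_single,
      sum_inner_single_sq]
    ring
  have hdual : (euclideanMetric EuclideanFour).innerDual x
      (mvfderiv 𝓘(ℝ, EuclideanFour) (fun y : EuclideanFour ↦ θ (‖y‖ ^ 2)) x).toLinearMap
      (mvfderiv 𝓘(ℝ, EuclideanFour) (fun y : EuclideanFour ↦ θ (‖y‖ ^ 2)) x).toLinearMap =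
      4 * deriv θ (‖x‖ ^ 2) ^ 2 * ‖x‖ ^ 2 := by
    rw [innerDual_euclidean hWs]
    have hterm : ∀ i : Fin 4, fderiv ℝ (fun y : EuclideanFour ↦ θ (‖y‖ ^ 2)) x (EuclideanSpace.single i 1) *
        fderiv ℝ (fun y : EuclideanFour ↦ θ (‖y‖ ^ 2)) x (EuclideanSpace.single i 1) =
        4 * deriv θ (‖x‖ ^ 2) ^ 2 * ⟪x, (EuclideanSpace.single i (1 : ℝ) : EuclideanFour)⟫ ^ 2 := by
      intro i
      rw [fderiv_radial_apply hθ]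
      ring
    simp_rw [hterm, ← Finset.mul_sum, sum_inner_single_sq]
  have hflatYY : (euclideanMetric EuclideanFour).val x Y Y = ‖Y‖ ^ 2 := by
    rw [euclideanMetric_apply]
    exact real_inner_self_eq_norm_sq Y
  rw [h, hric, hhess, hd, hlap, hdual, hflatYY]
  ring

/-- **Nonnegativity of the Ricci tensor** of `e^{2θ(‖x‖²)} δ` when both eigenvalues
`−12(a + bs)` (radial) and `−(12a + 4bs + 8a²s)` (tangential) are nonnegative: by Cauchy–Schwarz
`⟪x,Y⟫² ≤ ‖x‖² ‖Y‖²`, `Ric(Y,Y) ≥ min(radial, tangential) · ‖Y‖² ≥ 0`. [folklore] -/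
theorem ricci_radial_self_nonneg {θ : ℝ → ℝ} (hθ : ContDiff ℝ ∞ θ)
    (hR : ∀ s : ℝ, 0 ≤ s → deriv θ s + deriv (deriv θ) s * s ≤ 0)
    (hT : ∀ s : ℝ, 0 ≤ s → 12 * deriv θ s + 4 * deriv (deriv θ) s * s + 8 * deriv θ s ^ 2 * s ≤ 0)
    (gc : PseudoRiemannianMetric 𝓘(ℝ, EuclideanFour) ∞ EuclideanFour
      (TangentSpace 𝓘(ℝ, EuclideanFour) : EuclideanFour → Type _)) [gc.HasLeviCivita]
    (hval : ∀ (x : EuclideanFour) (v w : EuclideanFour),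
      gc.val x v w = Real.exp (2 * θ (‖x‖ ^ 2)) * ⟪v, w⟫)
    (x Y : EuclideanFour) : 0 ≤ gc.ricci x Y Y := by
  rw [ricci_radial_self hθ gc hval x Y]
  set a : ℝ := deriv θ (‖x‖ ^ 2)
  set b : ℝ := deriv (deriv θ) (‖x‖ ^ 2)
  set s : ℝ := ‖x‖ ^ 2 with hs
  have hs0 : 0 ≤ s := sq_nonneg _
  have hRs := hR s hs0
  have hTs := hT s hs0
  have hq : 0 ≤ ‖Y‖ ^ 2 := sq_nonneg _
  have hcs : ⟪x, Y⟫ ^ 2 ≤ s * ‖Y‖ ^ 2 := by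
    have h1 := abs_real_inner_le_norm x Y
    have h2 : ⟪x, Y⟫ ^ 2 = |⟪x, Y⟫| ^ 2 := (sq_abs _).symm
    rw [h2, hs, ← mul_pow]
    exact pow_le_pow_left₀ (abs_nonneg _) h1 2
  have hp : 0 ≤ ⟪x, Y⟫ ^ 2 := sq_nonneg _
  by_cases hab : 0 ≤ a ^ 2 - b
  · have h1 : 0 ≤ 8 * (a ^ 2 - b) * ⟪x, Y⟫ ^ 2 := by positivity
    nlinarith
  · rw [not_le] at hab
    have h1 : 8 * (a ^ 2 - b) * (s * ‖Y‖ ^ 2) ≤ 8 * (a ^ 2 - b) * ⟪x, Y⟫ ^ 2 :=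
      mul_le_mul_of_nonpos_left hcs (by linarith)
    nlinarith

end SmoothedConeModelMetric

/-- **Aux 1 of stub `helper_smoothedConeModel`: the radial conformally flat metric and its Ricci
sign.** For every smooth profile `θ : ℝ → ℝ` whose derivatives satisfy, for `s ≥ 0`,
`θ'(s) + s θ''(s) ≤ 0` (radial Ricci eigenvalue) and `12 θ'(s) + 4 s θ''(s) + 8 s θ'(s)² ≤ 0`
(tangential eigenvalue), the metric `g_c = e^{2θ(‖x‖²)} δ` on `ℝ⁴` is a smooth Riemannian
`PseudoRiemannianMetric` with Levi-Civita connection and `Ric(g_c) ≥ 0` (Besse 1987, Thm. 1.159 (d):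
for the conformally flat `e^{2W} δ`, `Ric = −2(∇²W − dW⊗dW) − (ΔW + 2|∇W|²)δ`).
[cite: Besse1987, Thm. 1.159 (d)] -/
theorem helper_smoothedConeModel_metric :
    ∀ θ : ℝ → ℝ, ContDiff ℝ ∞ θ →
      (∀ s : ℝ, 0 ≤ s → deriv θ s + deriv (deriv θ) s * s ≤ 0) →
      (∀ s : ℝ, 0 ≤ s → 12 * deriv θ s + 4 * deriv (deriv θ) s * s + 8 * deriv θ s ^ 2 * s ≤ 0) →
      ∃ gc : PseudoRiemannianMetric (𝓡 4) ∞ (EuclideanSpace ℝ (Fin 4))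
          (TangentSpace (𝓡 4) : EuclideanSpace ℝ (Fin 4) → Type _),
      ∃ _ : gc.HasLeviCivita, ∃ _ : gc.IsRiemannian,
        (∀ (x : EuclideanSpace ℝ (Fin 4)) (v w : EuclideanSpace ℝ (Fin 4)),
          gc.val x v w = Real.exp (2 * θ (‖x‖ ^ 2)) * ⟪v, w⟫) ∧
        ∀ (x : EuclideanSpace ℝ (Fin 4)) (X : TangentSpace (𝓡 4) x), 0 ≤ gc.ricci x X X := by
  intro θ hθ hR hT
  set ψ : EuclideanFour → ℝ := fun y ↦ Real.exp (θ (‖y‖ ^ 2)) with hψ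
  have hψs : ContMDiff 𝓘(ℝ, EuclideanFour) 𝓘(ℝ) ∞ ψ :=
    (Real.contDiff_exp.comp (hθ.comp (contDiff_norm_sq ℝ))).contMDiff
  have hψpos : ∀ y, 0 < ψ y := fun y ↦ Real.exp_pos _
  obtain ⟨gc, hgc, hval⟩ := ConformalRealisation.exists_isRiemannian_conformal_sq
    (euclideanMetric EuclideanFour) isRiemannian_euclideanMetric hψs hψpos
  haveI : gc.HasLeviCivita := gc.hasLeviCivita
  have hψ2 : ∀ x : EuclideanFour, ψ x ^ 2 = Real.exp (2 * θ (‖x‖ ^ 2)) := by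
    intro x
    rw [hψ, sq, ← Real.exp_add, two_mul]
  have hval' : ∀ (x : EuclideanFour) (v w : EuclideanFour),
      gc.val x v w = Real.exp (2 * θ (‖x‖ ^ 2)) * ⟪v, w⟫ := by
    intro x v w
    rw [hval x v w, euclideanMetric_apply, hψ2 x]
    rfl
  exact ⟨gc, inferInstance, hgc, hval',
    fun x X ↦ SmoothedConeModelMetric.ricci_radial_self_nonneg hθ hR hT gc hval' x X⟩

end Summit.SmoothPoincare4.SmoothPoincare4.Theorems
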